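import Mathlib
import Literature.Analysis.FluidPDE.CheskidovFriedlander2009.Existence
import HarnessLib

/-!
# Cheskidov–Friedlander 2009, Thm. 3.3 (energy inequality) — proved

Cheskidov–Friedlander, Physica D 238 (2009) 783–787 = arXiv:0810.3718v1, **Thm. 3.3** p. 7 ("Let
`a(t)` be a solution to (3.1) with `a_j(0) ≥ 0`. Then `a(t)` satisfies the energy inequality
`|a(t)|² + 2ν∫_{t₀}^t ‖a(τ)‖²_{H¹}dτ ≤ |a(t₀)|² + 2∫_{t₀}^t (f,a(τ))dτ` (3.2) for all
`0 ≤ t₀ ≤ t`"), quoted there from Cheskidov's theory; the same statement at `ν = 0` is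
Cheskidov–Friedlander–Pavlović 2010, Thm. 3.3 p. 5 ((3.8), with the proof (3.9)–(3.10): positivity,
then "multiplying (1.2) by `a_j`, taking a sum from `0` to `N`, and integrating between `t₀` and
`t` … `≤ 2∫Σf_ja_j`; taking the limit as `N → ∞`"). PROVED here for every solution
(`IsSolution`, `VanishingViscosityLimit.lean`) of the model (1.2) with non-negative datum, force
`f₀ ≥ 0` on the first shell, any exponent `c ≠ 0` and any viscosity `ν`, following the printed
proof: the truncated energy balance
`Σ_{j≤N}a_j(t)² − Σ_{j≤N}a_j(t₀)² = −2ν∫Σ_{j≤N}2^{2j}a_j² − 2∫2^{cN}a_N²a_{N+1} + 2∫f₀a₀`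
(`sum_mul_rhs`, `truncEnergy_eq`), the sign of the flux from positivity (`IsSolution.nonneg`,
`Existence.lean`), and the limit `N → ∞` (monotone convergence for the dissipation, in `[0,∞]`).

Main statements: `IsSolution.truncEnergy_le` (truncated (3.2), any `ν`),
`IsSolution.normSq_le` (`|a(t)|² ≤ |a(t₀)|² + 2f₀∫_{t₀}^t a₀` for `ν ≥ 0`),
`IsSolution.lintegral_h1NormSq_le` and `IsSolution.energy_ineq` ((3.2) with the time integral of
`‖a‖²_{H¹}` as a lower Lebesgue integral, `ν > 0`), `IsSolution.lintegral_h1NormSq_lt_top`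
(so `meanDissipation` carries no junk on these solutions). No new definitions, no new facts.
-/

noncomputable section

open Set MeasureTheory Filter
open scoped ENNReal BigOperators Topology

namespace Literature.Analysis.FluidPDE.CheskidovFriedlander2009

/-! ### The truncated energy balance (algebra) -/

/-- The flux telescopes: `Σ_{j≤N} x_j·rhs_j = −νΣ_{j≤N}2^{2j}x_j² − (2^c)^N x_N²x_{N+1} + Σ_{j≤N}f_jx_j`
(CFP 2010 (3.10): "multiplying (1.2) by `a_j`, taking a sum from `0` to `N`").
[cite: CheskidovFriedlanderPavlovic2010, Thm 3.3 (3.10) p.5] -/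
theorem sum_mul_rhs (c ν : ℝ) (f x : ℕ → ℝ) (N : ℕ) :
    ∑ j ∈ Finset.range (N + 1), x j * rhs c ν f x j =
      -ν * ∑ j ∈ Finset.range (N + 1), (2 : ℝ) ^ (2 * j) * x j ^ 2
        - ((2 : ℝ) ^ c) ^ N * x N ^ 2 * x (N + 1) + ∑ j ∈ Finset.range (N + 1), f j * x j := by
  induction N with
  | zero =>
    simp only [zero_add, Finset.sum_range_one, rhs, pow_zero, mul_zero, one_mul]
    ring
  | succ N ih =>
    rw [Finset.sum_range_succ, ih, Finset.sum_range_succ _ (N + 1), Finset.sum_range_succ _ (N + 1)]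
    simp only [rhs, show N + 1 + 1 = N + 2 from rfl]
    ring

/-- With the force on the first shell only, `Σ_{j≤N} f_j x_j = f₀x₀`.
[cite: CheskidovFriedlander2009, §1 (1.2) p.2] -/
theorem sum_force_mul (f₀ : ℝ) (x : ℕ → ℝ) (N : ℕ) :
    ∑ j ∈ Finset.range (N + 1), force f₀ j * x j = f₀ * x 0 := by
  induction N with
  | zero => simp [force_zero]
  | succ N ih => rw [Finset.sum_range_succ, ih, force_succ, zero_mul, add_zero]

variable {c ν f₀ : ℝ} {a : ℕ → ℝ → ℝ}

/-- Each mode of a solution is continuous on `[0,∞)`. [cite: CheskidovFriedlander2009, Def 3.1 p.7] -/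
theorem IsSolution.continuousOn {f : ℕ → ℝ} (ha : IsSolution c ν f a) (j : ℕ) :
    ContinuousOn (a j) (Ici 0) :=
  fun t ht => (ha.hasDerivWithinAt j t ht).continuousWithinAt

/-- Derivative of the truncated energy `Σ_{j≤N} a_j(τ)²` along a solution.
[cite: CheskidovFriedlanderPavlovic2010, Thm 3.3 (3.10) p.5] -/
theorem IsSolution.hasDerivWithinAt_truncEnergy {f : ℕ → ℝ} (ha : IsSolution c ν f a) (N : ℕ)
    {t : ℝ} (ht : 0 ≤ t) :
    HasDerivWithinAt (fun τ => ∑ j ∈ Finset.range (N + 1), a j τ ^ 2)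
      (2 * ∑ j ∈ Finset.range (N + 1), a j t * rhs c ν f (fun i => a i t) j) (Ici 0) t := by
  rw [Finset.mul_sum]
  have := HasDerivWithinAt.fun_sum (u := Finset.range (N + 1)) (A := fun j τ => a j τ ^ 2)
    (A' := fun j => 2 * a j t * rhs c ν f (fun i => a i t) j) (x := t) (s := Ici 0)
    fun j _ => by simpa using (ha.hasDerivWithinAt j t ht).fun_pow 2
  simpa [mul_assoc] using this

/-- **The truncated energy balance, integrated** (CFP 2010 (3.10) before the sign is used): for a
solution with force `f₀` on the first shell and `0 ≤ s ≤ t`,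
`Σ_{j≤N}a_j(t)² − Σ_{j≤N}a_j(s)² = −2ν∫_s^tΣ_{j≤N}2^{2j}a_j² − 2∫_s^t(2^c)^N a_N²a_{N+1} + 2f₀∫_s^t a₀`.
[cite: CheskidovFriedlanderPavlovic2010, Thm 3.3 (3.10) p.5] [cite: CheskidovFriedlander2009, Thm 3.3 p.7] -/
theorem IsSolution.truncEnergy_eq (ha : IsSolution c ν (force f₀) a) (N : ℕ) {s t : ℝ}
    (hs : 0 ≤ s) (hst : s ≤ t) :
    ∑ j ∈ Finset.range (N + 1), a j t ^ 2 - ∑ j ∈ Finset.range (N + 1), a j s ^ 2 =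
      -(2 * ν) * (∫ τ in s..t, ∑ j ∈ Finset.range (N + 1), (2 : ℝ) ^ (2 * j) * a j τ ^ 2)
        - 2 * (∫ τ in s..t, ((2 : ℝ) ^ c) ^ N * a N τ ^ 2 * a (N + 1) τ)
        + 2 * f₀ * ∫ τ in s..t, a 0 τ := by
  -- the players
  set E : ℝ → ℝ := fun τ => ∑ j ∈ Finset.range (N + 1), a j τ ^ 2 with hE
  set D : ℝ → ℝ := fun τ => ∑ j ∈ Finset.range (N + 1), (2 : ℝ) ^ (2 * j) * a j τ ^ 2 with hD
  set F : ℝ → ℝ := fun τ => ((2 : ℝ) ^ c) ^ N * a N τ ^ 2 * a (N + 1) τ with hF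
  have hcont := ha.continuousOn
  have hEc : ContinuousOn E (Ici 0) :=
    continuousOn_finsetSum _ fun j _ => (hcont j).pow 2
  have hDc : ContinuousOn D (Ici 0) :=
    continuousOn_finsetSum _ fun j _ => continuousOn_const.mul ((hcont j).pow 2)
  have hFc : ContinuousOn F (Ici 0) :=
    (continuousOn_const.mul ((hcont N).pow 2)).mul (hcont (N + 1))
  have hderiv : ∀ τ, 0 ≤ τ →
      HasDerivWithinAt E (-(2 * ν) * D τ - 2 * F τ + 2 * f₀ * a 0 τ) (Ici 0) τ := by
    intro τ hτ
    have h := ha.hasDerivWithinAt_truncEnergy N hτ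
    refine h.congr_deriv ?_
    rw [sum_mul_rhs, sum_force_mul]
    ring
  -- integrate
  have hst' : Icc s t ⊆ Ici 0 := fun τ hτ => hs.trans hτ.1
  have hDi : IntervalIntegrable D volume s t := (hDc.mono hst').intervalIntegrable_of_Icc hst
  have hFi : IntervalIntegrable F volume s t := (hFc.mono hst').intervalIntegrable_of_Icc hst
  have hAi : IntervalIntegrable (a 0) volume s t :=
    ((hcont 0).mono hst').intervalIntegrable_of_Icc hst
  have hftc := intervalIntegral.integral_eq_sub_of_hasDeriv_right_of_le hst (hEc.mono hst')
    (fun τ hτ => (hderiv τ (hs.trans hτ.1.le)).mono fun r hr => hs.trans (hτ.1.le.trans hr.le))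
    (((hDi.const_mul (-(2 * ν))).sub (hFi.const_mul 2)).add (hAi.const_mul (2 * f₀)))
  rw [intervalIntegral.integral_add ((hDi.const_mul _).sub (hFi.const_mul _)) (hAi.const_mul _),
    intervalIntegral.integral_sub (hDi.const_mul _) (hFi.const_mul _),
    intervalIntegral.integral_const_mul, intervalIntegral.integral_const_mul,
    intervalIntegral.integral_const_mul] at hftc
  show E t - E s = -(2 * ν) * (∫ τ in s..t, D τ) - 2 * (∫ τ in s..t, F τ) + 2 * f₀ * ∫ τ in s..t, a 0 τ
  linarith

/-! ### Thm. 3.3: the energy inequality -/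

/-- **Truncated energy inequality** (CFP 2010 (3.10) / CF 2009 Thm. 3.3 before `N → ∞`): for a
solution with non-negative datum, `f₀ ≥ 0`, `c ≠ 0` (any `ν`) and `0 ≤ s ≤ t`,
`Σ_{j≤N}a_j(t)² + 2ν∫_s^tΣ_{j≤N}2^{2j}a_j² ≤ Σ_{j≤N}a_j(s)² + 2f₀∫_s^t a₀` — the flux
`(2^c)^N a_N²a_{N+1}` is non-negative by positivity. [cite: CheskidovFriedlander2009, Thm 3.3 p.7]
[cite: CheskidovFriedlanderPavlovic2010, Thm 3.3 p.5] -/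
theorem IsSolution.truncEnergy_le (ha : IsSolution c ν (force f₀) a) (hc : c ≠ 0) (hf : 0 ≤ f₀)
    (h0 : ∀ j, 0 ≤ a j 0) (N : ℕ) {s t : ℝ} (hs : 0 ≤ s) (hst : s ≤ t) :
    ∑ j ∈ Finset.range (N + 1), a j t ^ 2
        + 2 * ν * (∫ τ in s..t, ∑ j ∈ Finset.range (N + 1), (2 : ℝ) ^ (2 * j) * a j τ ^ 2) ≤
      ∑ j ∈ Finset.range (N + 1), a j s ^ 2 + 2 * f₀ * ∫ τ in s..t, a 0 τ := by
  have heq := ha.truncEnergy_eq N hs hst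
  have hL : (0 : ℝ) < (2 : ℝ) ^ c := Real.rpow_pos_of_pos two_pos c
  have hF0 : 0 ≤ ∫ τ in s..t, ((2 : ℝ) ^ c) ^ N * a N τ ^ 2 * a (N + 1) τ :=
    intervalIntegral.integral_nonneg hst fun τ hτ =>
      mul_nonneg (mul_nonneg (pow_nonneg hL.le N) (sq_nonneg _))
        (ha.nonneg hc hf h0 (N + 1) τ (hs.trans hτ.1))
  linarith

/-- The tail-free consequence for `ν ≥ 0`: `Σ_{j≤N}a_j(t)² ≤ |a(s)|² + 2f₀∫_s^t a₀`.
[cite: CheskidovFriedlander2009, Thm 3.3 p.7] -/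
theorem IsSolution.truncEnergy_le_normSq (ha : IsSolution c ν (force f₀) a) (hc : c ≠ 0)
    (hν : 0 ≤ ν) (hf : 0 ≤ f₀) (h0 : ∀ j, 0 ≤ a j 0) (N : ℕ) {s t : ℝ} (hs : 0 ≤ s)
    (hst : s ≤ t) :
    ∑ j ∈ Finset.range (N + 1), a j t ^ 2 ≤ normSq (fun j => a j s) + 2 * f₀ * ∫ τ in s..t, a 0 τ := by
  have h := ha.truncEnergy_le hc hf h0 N hs hst
  have hD : 0 ≤ ∫ τ in s..t, ∑ j ∈ Finset.range (N + 1), (2 : ℝ) ^ (2 * j) * a j τ ^ 2 :=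
    intervalIntegral.integral_nonneg hst fun τ _ =>
      Finset.sum_nonneg fun j _ => mul_nonneg (pow_nonneg zero_le_two _) (sq_nonneg _)
  have hEs : ∑ j ∈ Finset.range (N + 1), a j s ^ 2 ≤ normSq (fun j => a j s) :=
    (ha.summable_sq s hs).sum_le_tsum (Finset.range (N + 1)) fun j _ => sq_nonneg _
  nlinarith

/-- **Energy does not exceed datum plus injected work** (Thm. 3.3 without the dissipation term,
`ν ≥ 0`): `|a(t)|² ≤ |a(s)|² + 2f₀∫_s^t a₀(τ)dτ` for `0 ≤ s ≤ t`.
[cite: CheskidovFriedlander2009, Thm 3.3 p.7] [cite: CheskidovFriedlanderPavlovic2010, Thm 3.3 (3.8) p.5] -/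
theorem IsSolution.normSq_le (ha : IsSolution c ν (force f₀) a) (hc : c ≠ 0) (hν : 0 ≤ ν)
    (hf : 0 ≤ f₀) (h0 : ∀ j, 0 ≤ a j 0) {s t : ℝ} (hs : 0 ≤ s) (hst : s ≤ t) :
    normSq (fun j => a j t) ≤ normSq (fun j => a j s) + 2 * f₀ * ∫ τ in s..t, a 0 τ := by
  have hlim : Tendsto (fun N => ∑ j ∈ Finset.range (N + 1), a j t ^ 2) atTop
      (𝓝 (normSq (fun j => a j t))) :=
    ((ha.summable_sq t (hs.trans hst)).hasSum.tendsto_sum_nat).comp (tendsto_add_atTop_nat 1)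
  exact le_of_tendsto' hlim fun N => ha.truncEnergy_le_normSq hc hν hf h0 N hs hst

/-! ### The dissipation term: `N → ∞` by monotone convergence in `[0,∞]` -/

/-- The lower integral of the truncated dissipation density is the `ofReal` of its interval
integral (continuous non-negative integrand) — bookkeeping for the step "taking the limit as
`N → ∞`" of the printed proof. [cite: CheskidovFriedlanderPavlovic2010, Thm 3.3 (3.10) p.5] -/
theorem IsSolution.lintegral_truncDissipation_eq {f : ℕ → ℝ} (ha : IsSolution c ν f a) (N : ℕ)
    {s t : ℝ} (hs : 0 ≤ s) (hst : s ≤ t) :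
    ∫⁻ τ in Ioc s t, ∑ j ∈ Finset.range (N + 1), ENNReal.ofReal ((2 : ℝ) ^ (2 * j) * a j τ ^ 2) =
      ENNReal.ofReal (∫ τ in s..t, ∑ j ∈ Finset.range (N + 1), (2 : ℝ) ^ (2 * j) * a j τ ^ 2) := by
  have hnn : ∀ τ j, 0 ≤ (2 : ℝ) ^ (2 * j) * a j τ ^ 2 := fun τ j =>
    mul_nonneg (pow_nonneg zero_le_two _) (sq_nonneg _)
  have hDc : ContinuousOn (fun τ => ∑ j ∈ Finset.range (N + 1), (2 : ℝ) ^ (2 * j) * a j τ ^ 2)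
      (Icc s t) :=
    (continuousOn_finsetSum _ fun j _ =>
      continuousOn_const.mul ((ha.continuousOn j).pow 2)).mono fun τ hτ => hs.trans hτ.1
  have hint : IntegrableOn (fun τ => ∑ j ∈ Finset.range (N + 1), (2 : ℝ) ^ (2 * j) * a j τ ^ 2)
      (Ioc s t) :=
    (hDc.integrableOn_compact isCompact_Icc).mono_set Ioc_subset_Icc_self
  rw [intervalIntegral.integral_of_le hst,
    ofReal_integral_eq_lintegral_ofReal hint (ae_of_all _ fun τ => Finset.sum_nonneg fun j _ => hnn τ j)]
  refine lintegral_congr fun τ => ?_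
  rw [ENNReal.ofReal_sum_of_nonneg fun j _ => hnn τ j]

/-- The lower integral of `‖a(τ)‖²_{H¹}` over `(s,t]` is the supremum of the truncated ones
(monotone convergence) — the step "taking the limit as `N → ∞`" of the printed proof.
[cite: CheskidovFriedlanderPavlovic2010, Thm 3.3 (3.10) p.5] [cite: CheskidovFriedlander2009, Thm 3.3 p.7] -/
theorem IsSolution.lintegral_h1NormSq_eq_iSup {f : ℕ → ℝ} (ha : IsSolution c ν f a) {s t : ℝ}
    (hs : 0 ≤ s) :
    ∫⁻ τ in Ioc s t, h1NormSq (fun j => a j τ) =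
      ⨆ N : ℕ, ∫⁻ τ in Ioc s t, ∑ j ∈ Finset.range N,
        ENNReal.ofReal ((2 : ℝ) ^ (2 * j) * a j τ ^ 2) := by
  have hmeas : ∀ j, AEMeasurable (fun τ => ENNReal.ofReal ((2 : ℝ) ^ (2 * j) * a j τ ^ 2))
      (volume.restrict (Ioc s t)) := fun j =>
    (((continuousOn_const.mul ((ha.continuousOn j).pow 2)).mono
      fun τ hτ => hs.trans hτ.1.le).aemeasurable measurableSet_Ioc).ennreal_ofReal
  unfold h1NormSq
  rw [lintegral_tsum hmeas, ENNReal.tsum_eq_iSup_nat]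
  refine iSup_congr fun N => ?_
  rw [lintegral_finsetSum' _ fun j _ => hmeas j]

/-- **The dissipation bound** (Thm. 3.3, dissipation part, `ν > 0`): for a solution with
non-negative datum, `f₀ ≥ 0`, `c ≠ 0` and `0 ≤ s ≤ t`,
`2ν∫_s^t‖a(τ)‖²_{H¹}dτ ≤ |a(s)|² + 2f₀∫_s^t a₀ − |a(t)|²`, the time integral being the lower
Lebesgue integral of the `[0,∞]`-valued `H¹` norm. [cite: CheskidovFriedlander2009, Thm 3.3 p.7] -/
theorem IsSolution.lintegral_h1NormSq_le (ha : IsSolution c ν (force f₀) a) (hc : c ≠ 0)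
    (hν : 0 < ν) (hf : 0 ≤ f₀) (h0 : ∀ j, 0 ≤ a j 0) {s t : ℝ} (hs : 0 ≤ s) (hst : s ≤ t) :
    ∫⁻ τ in Ioc s t, h1NormSq (fun j => a j τ) ≤
      ENNReal.ofReal ((normSq (fun j => a j s) + 2 * f₀ * (∫ τ in s..t, a 0 τ)
        - normSq (fun j => a j t)) / (2 * ν)) := by
  set B : ℝ := normSq (fun j => a j s) + 2 * f₀ * (∫ τ in s..t, a 0 τ) with hB
  -- the truncated dissipations `∫_s^t D_M`
  set ID : ℕ → ℝ := fun M => ∫ τ in s..t, ∑ j ∈ Finset.range (M + 1), (2 : ℝ) ^ (2 * j) * a j τ ^ 2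
    with hID
  have hnn : ∀ τ j, 0 ≤ (2 : ℝ) ^ (2 * j) * a j τ ^ 2 := fun τ j =>
    mul_nonneg (pow_nonneg zero_le_two _) (sq_nonneg _)
  have hst' : Icc s t ⊆ Ici 0 := fun τ hτ => hs.trans hτ.1
  have hDint : ∀ M, IntervalIntegrable
      (fun τ => ∑ j ∈ Finset.range (M + 1), (2 : ℝ) ^ (2 * j) * a j τ ^ 2) volume s t := fun M =>
    ((continuousOn_finsetSum _ fun j _ =>
      continuousOn_const.mul ((ha.continuousOn j).pow 2)).mono hst').intervalIntegrable_of_Icc hst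
  -- `M ↦ ∫_s^t D_M` is monotone
  have hIDmono : Monotone ID := by
    refine monotone_nat_of_le_succ fun M => ?_
    simp only [hID]
    refine intervalIntegral.integral_mono_on hst (hDint M) (hDint (M + 1)) fun τ _ => ?_
    exact Finset.sum_le_sum_of_subset_of_nonneg
      (Finset.range_mono (by omega)) fun j _ _ => hnn τ j
  -- for every `M`: `2ν ∫_s^t D_M ≤ B − |a(t)|²` (let `M' → ∞` in the truncated inequality)
  have hlimE : Tendsto (fun M => ∑ j ∈ Finset.range (M + 1), a j t ^ 2) atTop
      (𝓝 (normSq (fun j => a j t))) :=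
    ((ha.summable_sq t (hs.trans hst)).hasSum.tendsto_sum_nat).comp (tendsto_add_atTop_nat 1)
  have hkey : ∀ M, 2 * ν * ID M ≤ B - normSq (fun j => a j t) := by
    intro M
    -- `2ν ID M + E_{M'}(t) ≤ B` for all `M' ≥ M`
    have hev : ∀ᶠ M' in atTop, 2 * ν * ID M + ∑ j ∈ Finset.range (M' + 1), a j t ^ 2 ≤ B := by
      refine eventually_atTop.2 ⟨M, fun M' hMM' => ?_⟩
      have h1 := ha.truncEnergy_le hc hf h0 M' hs hst
      have hEs : ∑ j ∈ Finset.range (M' + 1), a j s ^ 2 ≤ normSq (fun j => a j s) :=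
        (ha.summable_sq s hs).sum_le_tsum (Finset.range (M' + 1)) fun j _ => sq_nonneg _
      have h2 : ID M ≤ ID M' := hIDmono hMM'
      have h3 : 2 * ν * ID M ≤ 2 * ν * ID M' := mul_le_mul_of_nonneg_left h2 (by positivity)
      simp only [hID] at h3 ⊢
      linarith
    have hlim2 : Tendsto (fun M' => 2 * ν * ID M + ∑ j ∈ Finset.range (M' + 1), a j t ^ 2) atTop
        (𝓝 (2 * ν * ID M + normSq (fun j => a j t))) := tendsto_const_nhds.add hlimE
    have := le_of_tendsto hlim2 hev
    linarith
  -- pass to the supremum in `[0,∞]`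
  rw [ha.lintegral_h1NormSq_eq_iSup hs]
  refine iSup_le fun N => ?_
  cases N with
  | zero => simp
  | succ M =>
    rw [ha.lintegral_truncDissipation_eq M hs hst]
    refine ENNReal.ofReal_le_ofReal ?_
    rw [le_div_iff₀ (by positivity)]
    have := hkey M
    simp only [hID] at this
    linarith

/-- **Finite dissipation** (`ν > 0`): `∫_s^t ‖a(τ)‖²_{H¹}dτ < ∞` for `0 ≤ s ≤ t` — so
`meanDissipation ν a T` carries no junk value on these solutions.
[cite: CheskidovFriedlander2009, Thm 3.3 p.7] -/
theorem IsSolution.lintegral_h1NormSq_lt_top (ha : IsSolution c ν (force f₀) a) (hc : c ≠ 0)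
    (hν : 0 < ν) (hf : 0 ≤ f₀) (h0 : ∀ j, 0 ≤ a j 0) {s t : ℝ} (hs : 0 ≤ s) (hst : s ≤ t) :
    ∫⁻ τ in Ioc s t, h1NormSq (fun j => a j τ) < ⊤ :=
  lt_of_le_of_lt (ha.lintegral_h1NormSq_le hc hν hf h0 hs hst) ENNReal.ofReal_lt_top

/-- **Cheskidov–Friedlander 2009, Theorem 3.3 (energy inequality), proved** (`ν > 0`, force
`f₀ ≥ 0` on the first shell, `c ≠ 0`): for every solution with non-negative datum and all
`0 ≤ s ≤ t`, `|a(t)|² + 2ν∫_s^t‖a(τ)‖²_{H¹}dτ ≤ |a(s)|² + 2∫_s^t (f,a(τ))dτ` (3.2), with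
`(f,a(τ)) = f₀a₀(τ)` and the dissipation integral the (finite, by `lintegral_h1NormSq_lt_top`)
lower Lebesgue integral of the `[0,∞]`-valued `H¹` norm, converted to a real number.
[cite: CheskidovFriedlander2009, Thm 3.3 (3.2) p.7] [cite: CheskidovFriedlanderPavlovic2010, Thm 3.3 (3.8) p.5] -/
theorem IsSolution.energy_ineq (ha : IsSolution c ν (force f₀) a) (hc : c ≠ 0) (hν : 0 < ν)
    (hf : 0 ≤ f₀) (h0 : ∀ j, 0 ≤ a j 0) {s t : ℝ} (hs : 0 ≤ s) (hst : s ≤ t) :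
    normSq (fun j => a j t) + 2 * ν * (∫⁻ τ in Ioc s t, h1NormSq (fun j => a j τ)).toReal ≤
      normSq (fun j => a j s) + 2 * ∫ τ in s..t, f₀ * a 0 τ := by
  have hle := ha.lintegral_h1NormSq_le hc hν hf h0 hs hst
  have hE := ha.normSq_le hc hν.le hf h0 hs hst
  have hnum : 0 ≤ (normSq (fun j => a j s) + 2 * f₀ * (∫ τ in s..t, a 0 τ)
      - normSq (fun j => a j t)) / (2 * ν) := div_nonneg (by linarith) (by positivity)
  have hreal : (∫⁻ τ in Ioc s t, h1NormSq (fun j => a j τ)).toReal ≤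
      (normSq (fun j => a j s) + 2 * f₀ * (∫ τ in s..t, a 0 τ) - normSq (fun j => a j t))
        / (2 * ν) := by
    have := ENNReal.toReal_mono ENNReal.ofReal_ne_top hle
    rwa [ENNReal.toReal_ofReal hnum] at this
  rw [intervalIntegral.integral_const_mul]
  have h2 := mul_le_mul_of_nonneg_left hreal (by positivity : (0 : ℝ) ≤ 2 * ν)
  rw [mul_div_cancel₀ _ (by positivity : (2 : ℝ) * ν ≠ 0)] at h2
  linarith

/-- The mean dissipation of Thm. 4.2 is bounded by the injected work per unit time plus the
initial energy: `T⁻¹∫₀ᵀ ν‖a‖²_{H¹} ≤ (2T)⁻¹|a(0)|² + f₀·T⁻¹∫₀ᵀ a₀` (`T > 0`; the first step of the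
proof of Thm. 4.2, p. 9). [cite: CheskidovFriedlander2009, Thm 4.2 p.9 (proof, first display)] -/
theorem IsSolution.meanDissipation_le (ha : IsSolution c ν (force f₀) a) (hc : c ≠ 0) (hν : 0 < ν)
    (hf : 0 ≤ f₀) (h0 : ∀ j, 0 ≤ a j 0) {T : ℝ} (hT : 0 < T) :
    meanDissipation ν a T ≤
      (2 * T)⁻¹ * normSq (fun j => a j 0) + f₀ * (T⁻¹ * ∫ τ in (0 : ℝ)..T, a 0 τ) := by
  have h := ha.energy_ineq hc hν hf h0 le_rfl hT.le
  have hEt : 0 ≤ normSq (fun j => a j T) := tsum_nonneg fun j => sq_nonneg _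
  rw [intervalIntegral.integral_const_mul] at h
  unfold meanDissipation
  have hX : ν * (∫⁻ τ in Ioc (0 : ℝ) T, h1NormSq (fun j => a j τ)).toReal ≤
      normSq (fun j => a j 0) / 2 + f₀ * ∫ τ in (0 : ℝ)..T, a 0 τ := by linarith
  have hT' : 0 < T⁻¹ := inv_pos.mpr hT
  calc ν * (T⁻¹ * (∫⁻ τ in Ioc (0 : ℝ) T, h1NormSq (fun j => a j τ)).toReal)
      = T⁻¹ * (ν * (∫⁻ τ in Ioc (0 : ℝ) T, h1NormSq (fun j => a j τ)).toReal) := by ring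
    _ ≤ T⁻¹ * (normSq (fun j => a j 0) / 2 + f₀ * ∫ τ in (0 : ℝ)..T, a 0 τ) :=
        mul_le_mul_of_nonneg_left hX hT'.le
    _ = (2 * T)⁻¹ * normSq (fun j => a j 0) + f₀ * (T⁻¹ * ∫ τ in (0 : ℝ)..T, a 0 τ) := by
        field_simp

end Literature.Analysis.FluidPDE.CheskidovFriedlander2009

end
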